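import Summits.AtomisticToContinuum.HydrodynamicLimit.Theorems.OneFlightGossipEngineSuperExponentialEnergyTailsSeetOfGevrey
import Summits.AtomisticToContinuum.HydrodynamicLimit.Theorems.OneFlightGossipEngineSuperExponentialEnergyTailsGevreyInduction
import Summits.AtomisticToContinuum.HydrodynamicLimit.Theorems.OneFlightGossipEngineSuperExponentialEnergyTailsMomentRegularity
import Summits.AtomisticToContinuum.HydrodynamicLimit.Theorems.OneFlightGossipEngineSuperExponentialEnergyTailsHierarchyOfInputs
import HarnessLib

/-!
# Crux `SuperExponentialEnergyTails` (stmt-AtomisticToContinuum-17701), line `Sketch`: the crux from its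
# three true-law contact inputs (the glue of the split)

Lead prover-line-stmt-AtomisticToContinuum-17701-0.  The registered skeleton
`Cruxes/SuperExponentialEnergyTails/Lines/Sketch.lean` (v2) with every PROVABLE stub replaced by its landed
theorem: the transfer `stub_seetOfGevreyHierarchy` (order after level, Gevrey class `β < 2`), the abstract
Gevrey induction `stub_gevreyInduction` (pure real analysis over `MomentSystem`), the regularity and exact
power ledger of the true-law moments `stub_momentRegularity`, and the assembly `stub_gevreyHierarchyOfInputs`.
What remains are the three conjecture-grade TRUE-LAW contact inputs of
`Theorems/OneFlightGossipEngineSuperExponentialEnergyTailsDefsB.lean` §3 — `PovznerCeiling` (order-uniform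
Povzner/split ceiling), `ChaosCeiling` (one-sided chaos for pair marks, order-polynomial constant),
`RateFloor` (rate floor for energetic spheres, weight-uniform) — the order-uniform twins of the filed
primitives SD / S2a″ / RF₂ of crux `EnergyCurrentTails` (stmt-9235).

`SuperExponentialEnergyTails_of_contactInputs : PovznerCeiling → ChaosCeiling → RateFloor → SEET` (route
decl, by name) is the glue-by theorem of the split SEET ⟸ SD_∀k ∧ CE_∀(j,l) ∧ F_∀k.
-/

noncomputable section

namespace Summit.AtomisticToContinuum.HydrodynamicLimit.Theorems.SuperExponentialEnergyTailsSplit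

open Summit.AtomisticToContinuum.HydrodynamicLimit.Theorems.SuperExponentialEnergyTailsLine
  (VelocityMomentGevreyHierarchy PovznerCeiling ChaosCeiling RateFloor MomentRegularity GevreyInduction)
open Summit.AtomisticToContinuum.HydrodynamicLimit.Theorems.SuperExponentialEnergyTailsSeetOfGevrey
  (stub_seetOfGevreyHierarchy)
open Summit.AtomisticToContinuum.HydrodynamicLimit.Theorems.SuperExponentialEnergyTailsGevreyInduction
  (stub_gevreyInduction)
open Summit.AtomisticToContinuum.HydrodynamicLimit.Theorems.SuperExponentialEnergyTailsMomentRegularity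
  (stub_momentRegularity)
open Summit.AtomisticToContinuum.HydrodynamicLimit.Theorems.SuperExponentialEnergyTailsHierarchyOfInputs
  (stub_gevreyHierarchyOfInputs)

/-- **The Gevrey-3/2 velocity moment hierarchy of the true pre-shock law from the three contact inputs**
(exact power ledger + Povzner ceiling + chaos ceiling + rate floor assembled into a `MomentSystem`, then the
abstract induction). -/
theorem gevreyHierarchy_of_contactInputs (hSD : PovznerCeiling) (hCE : ChaosCeiling) (hF : RateFloor) :
    VelocityMomentGevreyHierarchy ((3 : ℝ) / 2) :=
  stub_gevreyHierarchyOfInputs stub_gevreyInduction stub_momentRegularity hSD hCE hF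

/-- **SEET from its three true-law contact inputs** (glue of the split of crux stmt-AtomisticToContinuum-17701):
`PovznerCeiling → ChaosCeiling → RateFloor → SuperExponentialEnergyTails` (route decl of OneFlightGossipEngine,
by name — through the landed byte-identical twin `ClampedTransferDockCubicRate.SuperExponentialEnergyTails`),
by the order-after-level transfer at `β = 3/2 < 2`. -/
theorem SuperExponentialEnergyTails_of_contactInputs :
    PovznerCeiling → ChaosCeiling → RateFloor →
      Summit.AtomisticToContinuum.HydrodynamicLimit.Theses.OneFlightGossipEngine.SuperExponentialEnergyTails :=
  fun hSD hCE hF =>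
    stub_seetOfGevreyHierarchy ((3 : ℝ) / 2) (by norm_num) (by norm_num) (gevreyHierarchy_of_contactInputs hSD hCE hF)

end Summit.AtomisticToContinuum.HydrodynamicLimit.Theorems.SuperExponentialEnergyTailsSplit

end
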